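import Literature.NumberTheory.Automorphic.Liu2021.AppendixC.EtaleH1TowerCharacterOfFrobenius
import Literature.NumberTheory.Automorphic.Liu2021.AppendixC.EtaleH1TowerScalarOnRankOneBlock
import Literature.NumberTheory.GaloisRepresentations.CharacterFromFrobeniusPair
import Literature.NumberTheory.Automorphic.FixedDegreeOnePlacesFinite
import Literature.NumberTheory.GaloisRepresentations.HeckeCharacterMuAlgGalConjTwist
import Literature.NumberTheory.GaloisRepresentations.HeckeCharacterInfinityTypeUnique
import HarnessLib

/-!
# [Liu2021, Thm. D.6 (1)] — the ABSTRACT composition of its proof (steps 2–5), sockets as hypotheses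

Topic `Literature/NumberTheory/Automorphic/Liu2021/AppendixC`; namespace `Literature.NumberTheory.Automorphic.Liu2021.AppendixC.ThmD6Glue`.
THEOREMS ONLY (no definition, no named fact, no instance, no `sorry`).  Cell hodgecm-mathlib, d6 line of crux `HLiu418`: this is Part A of
the probe `D6GlueProbe` (A-p15 (g10), skeleton of record v10, A-plan2 (g11) 2026-08-29), made a Literature file so that the next run's
`Cruxes/HLiu418/Lines/d6_cm_curve.lean` imports it by name.

PRINT. [Liu2021] App. D, proof of Thm. D.6 (1) (FJcycle.tex l. 5619–5632, print pp. 139–140): for `π^∞ ≅ ω(μ, ε, χ)` let `μ̃ := ρ_ℓ(π^∞)`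
be the character by which `Γ_E` acts on the `π^∞`-Hom-space of `ℚ̄_ℓ ⊗ H¹_ét` (Prop. D.4 (1)); `μ₁ := μ|·|^{−1/2}`, `μ₂ := μᶜχ̌|·|^{−1/2}`;
STEP 2 (l. 5624) «Cor. D.9 implies `μ̃_𝔮 ∈ {μ_{1,𝔮}, μ_{2,𝔮}}` for every degree-one prime `𝔮 ∈ Σ(π^∞)` coprime to `ℓ`»; STEP 3 (l. 5624–5628)
«`μ̃ ∈ {μ₁, μ₂}`» (two algebraic characters agreeing with a third on a density-one / Frobenius-dense set of places); STEP 4 (l. 5628–5630)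
«`μ̃ ≠ μ₂`» by the infinity types at `τ₁` («`μ₁μ₂⁻¹` is not a Dirichlet character»); STEP 5: hence `μ̃ = μ₁` at EVERY unramified place.
Here, for a §4.2 datum `C` (★ `Sec42Data`), an étale Hecke datum `X` (★ `EtaleHeckeDatum`), `ι : ℂ ≃ ℚ̄_ℓ` and ANY `ℂ[𝔾(𝔸_F^∞)]`-module `(W, ρW)`
with Hom-space `Homs := X.omegaHom ι ρW` (★ `Thm415Pinned` §2), the three SOCKETS are HYPOTHESES spelled inline:
* S1′ «`Γ_E` acts on the block `{f w}` by scalars» (⇐ Prop. D.4 (1), ★ `EtaleH1TowerScalarOnRankOneBlock`; wrappers `gs1_of_span_singleton`,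
  `gs1_of_pairwise_proportional`);
* S2 «if the block is non-zero: an algebraic ψ with prescribed first exponent at `w₁` and ONE non-zero class `y` in the span of the block on which
  almost every arithmetic Frobenius acts by `(ι ψ(ϖ_v))⁻¹`» (⇐ §D.4 l. 5626–5628 + ★ `EtaleH1TowerCMQuotient`);
* S34 «SM ⊕ S3 ⊕ S4»: spherical predicates `Sph`, Hecke operators `T, S` (opaque), a finite exceptional set; SM every vector is spherical a.e.;
  S3 the congruence relation [Cor. D.9] on Hom-values in the ARITHMETIC-INVERSE form `q_v • Φ(Φ(f (S v x))) − Φ(f (T v x)) + f x = 0`; S4 the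
  eigenvalues [Lem. D.1, proof l. 5241] `T v x = (b₁ + b₂) • x`, `q_v • S v x = b₁b₂ • x`, `b_i = μ_i(ϖ_v)`.
ORIENTATION / DICTIONARY (for `s3_arith_of_geom` / `s3_geom_of_arith`): print's Cor. D.9 (l. 5580–5584) is «the action `(σ⁻¹)^*` of the
GEOMETRIC Frobenius satisfies `X² − t_ϖ^* X + q⟨ϖ⟩^* = 0`»; the tree's `towerRep ℓ σ` is the standard action on `H¹ = V_ℓ^∨`
(`φ ↦ φ ∘ ρ(σ⁻¹)`, ★ `galoisH1Bar_tmul`), so that action is `towerRep(σ_geom) = towerRep(σ_arith)⁻¹`; substituting and multiplying by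
`towerRep(σ_arith)²` gives the arithmetic-inverse form; the étale Hecke action is PULLBACK along the RIGHT translates (★ `HeckeTranslates.tr`,
★ `etHecke_toTower`), so `heckeOperator X.rhoEt K t = Σ_{y ∈ KtK/K} T_y^*` is print's `t_ϖ^*` (not `[Kt⁻¹K]`).
MAIN THEOREM `towerRep_eq_inv_smul_muAlg_of_sockets`: S1′ → S2 → S34 → at EVERY place `v ∤ ℓ` where `μ^{alg}` is unramified, every arithmetic
Frobenius acts on every value of the block by `(ι (μ^{alg}(ϖ_v)))⁻¹`.  Engines: ★ `HeckeCharacter.IsAlgebraic.eq_or_eq_of_valueAtUniformizer_of_dense`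
(step 3), ★ `absoluteGaloisGroup.frobenius_dense_smul_ne` (density at split places), ★ `HasInfinityType.eq_of_isComplex` + `odd_infinityType`
(step 4), ★ `Sec42Data.towerRep_baseChange_eq_inv_smul_of_eventually` (step 5).  HC_CM is proved only modulo the 7 printed citations
until rung 0 closes; nothing here moves a book.

## References
* [Liu2021] Y. Liu, *Fourier–Jacobi cycles and arithmetic relative trace formula*, Camb. J. Math. 9 (2021) = arXiv:2102.11518, App. D:
  Prop. D.4 (1), Rem. D.5, Thm. D.6 (1) and its proof (l. 5619–5632), Cor. D.9 (l. 5579–5584), Lem. D.1 proof (l. 5241).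
* [Weil1956] A. Weil, *On a certain type of characters of the idèle-class group of an algebraic number-field* (1956), §1.
-/

noncomputable section

open scoped TensorProduct NumberField
open NumberField IsDedekindDomain Filter
open Literature.NumberTheory.GaloisRepresentations
open Literature.NumberTheory.Automorphic
open Literature.NumberTheory.Automorphic.Liu2021.AppendixC

namespace Literature.NumberTheory.Automorphic.Liu2021.AppendixC.ThmD6Glue

variable {F E : Type} [Field F] [NumberField F] [IsTotallyReal F] [Field E] [NumberField E] [Algebra F E]
  [IsTotallyComplex E] [Algebra.IsQuadraticExtension F E]
variable {P5 : PropC5Data F E} {isotropicAt : ℕ → Prop}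

/-- Only finitely many finite places of a number field lie above the prime `ℓ`. [folklore]
[cite: Liu2021, App. D, proof of Thm. D.6 (1) (FJcycle.tex l. 5619–5632)] -/
theorem finite_setOf_natCast_mem_asIdeal {K : Type*} [Field K] [NumberField K] (ℓ : ℕ) [Fact ℓ.Prime] :
    {v : HeightOneSpectrum (𝓞 K) | (ℓ : 𝓞 K) ∈ v.asIdeal}.Finite := by
  have hI : (Ideal.span {(ℓ : 𝓞 K)} : Ideal (𝓞 K)) ≠ ⊥ := by
    rw [Ne, Ideal.span_singleton_eq_bot]
    exact_mod_cast (Fact.out : ℓ.Prime).ne_zero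
  exact (Ideal.finite_factors hI).subset fun v hv => Ideal.dvd_span_singleton.2 hv



section Steps

variable (C : Sec42Data P5 isotropicAt) (ℓ : ℕ) [Fact ℓ.Prime] (X : C.EtaleHeckeDatum ℓ)
  (ι : ℂ ≃+* AlgebraicClosure ℚ_[ℓ]) {W : Type} [AddCommGroup W] [Module ℂ W] (ρW : Representation ℂ C.G W)

/-- GS1 propagates from the block to its `ℚ̄_ℓ`-span.
[cite: Liu2021, App. D, proof of Thm. D.6 (1) (FJcycle.tex l. 5619–5632)] -/
theorem towerRep_eq_smul_of_mem_span {m : Field.absoluteGaloisGroup E → AlgebraicClosure ℚ_[ℓ]}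
    (hm : ∀ σ : Field.absoluteGaloisGroup E, ∀ f ∈ X.omegaHom ι ρW, ∀ w : W,
      (C.towerRep ℓ σ).baseChange (AlgebraicClosure ℚ_[ℓ]) (f w) = m σ • f w)
    (σ : Field.absoluteGaloisGroup E) {z : AlgebraicClosure ℚ_[ℓ] ⊗[ℚ_[ℓ]] C.etaleH1Tower ℓ}
    (hz : z ∈ Submodule.span (AlgebraicClosure ℚ_[ℓ]) {y | ∃ f ∈ X.omegaHom ι ρW, ∃ w : W, f w = y}) :
    (C.towerRep ℓ σ).baseChange (AlgebraicClosure ℚ_[ℓ]) z = m σ • z := by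
  induction hz using Submodule.span_induction with
  | mem z hz =>
    obtain ⟨f, hf, w, rfl⟩ := hz
    exact hm σ f hf w
  | zero => simp
  | add a b _ _ ha hb => rw [map_add, ha, hb, smul_add]
  | smul r a _ ha => rw [map_smul, ha, smul_comm]

/-- **Step 2 (the root dichotomy at one place)** — from GS1's scalar `m σ`, S4's eigenvalues and S3's relation at a
vector `x ∈ Sph v` with `f x ≠ 0`: `m σ = (ι b₁)⁻¹ ∨ m σ = (ι b₂)⁻¹`. Pure algebra: `f` is `ι`-semilinear, so the
relation reads `((ι b₁)(ι b₂) m² − (ι b₁ + ι b₂) m + 1) • f x = 0 = ((m ι b₁ − 1)(m ι b₂ − 1)) • f x`.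
[cite: Liu2021, App. D, proof of Thm. D.6 (1) (FJcycle.tex l. 5619–5632)] -/
theorem scalar_eq_inv_or_eq_inv {m : AlgebraicClosure ℚ_[ℓ]} {σ : Field.absoluteGaloisGroup E}
    {f : W →ₛₗ[(ι : ℂ →+* AlgebraicClosure ℚ_[ℓ])] AlgebraicClosure ℚ_[ℓ] ⊗[ℚ_[ℓ]] C.etaleH1Tower ℓ}
    (hm : ∀ w : W, (C.towerRep ℓ σ).baseChange (AlgebraicClosure ℚ_[ℓ]) (f w) = m • f w)
    {T S : W →ₗ[ℂ] W} {x : W} {b₁ b₂ : ℂ} {q : ℕ}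
    (hT : T x = (b₁ + b₂) • x) (hS : (q : ℂ) • S x = (b₁ * b₂) • x)
    (hrel : (q : AlgebraicClosure ℚ_[ℓ]) •
        (C.towerRep ℓ σ).baseChange (AlgebraicClosure ℚ_[ℓ])
          ((C.towerRep ℓ σ).baseChange (AlgebraicClosure ℚ_[ℓ]) (f (S x))) -
      (C.towerRep ℓ σ).baseChange (AlgebraicClosure ℚ_[ℓ]) (f (T x)) + f x = 0)
    (hx : f x ≠ 0) :
    m = (ι b₁)⁻¹ ∨ m = (ι b₂)⁻¹ := by
  have hTf : f (T x) = (ι b₁ + ι b₂) • f x := by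
    rw [hT, map_smulₛₗ, map_add]; rfl
  have hSf : (q : AlgebraicClosure ℚ_[ℓ]) • f (S x) = (ι b₁ * ι b₂) • f x := by
    have h1 : f ((q : ℂ) • S x) = (q : AlgebraicClosure ℚ_[ℓ]) • f (S x) := by
      rw [map_smulₛₗ]
      congr 1
      exact map_natCast (ι : ℂ →+* AlgebraicClosure ℚ_[ℓ]) q
    rw [← h1, hS, map_smulₛₗ, map_mul]; rfl
  have key : ((m * ι b₁ - 1) * (m * ι b₂ - 1)) • f x = 0 := by
    have e1 : (q : AlgebraicClosure ℚ_[ℓ]) •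
        (C.towerRep ℓ σ).baseChange (AlgebraicClosure ℚ_[ℓ])
          ((C.towerRep ℓ σ).baseChange (AlgebraicClosure ℚ_[ℓ]) (f (S x))) = (m * m * (ι b₁ * ι b₂)) • f x := by
      rw [hm, map_smul, hm, smul_smul, smul_smul,
        show ((q : AlgebraicClosure ℚ_[ℓ]) * m * m) = (m * m) * (q : AlgebraicClosure ℚ_[ℓ]) by ring, ← smul_smul, hSf,
        smul_smul]
    have e2 : (C.towerRep ℓ σ).baseChange (AlgebraicClosure ℚ_[ℓ]) (f (T x)) = (m * (ι b₁ + ι b₂)) • f x := by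
      rw [hm, hTf, smul_smul]
    rw [e1, e2] at hrel
    have : ((m * ι b₁ - 1) * (m * ι b₂ - 1)) • f x =
        (m * m * (ι b₁ * ι b₂)) • f x - (m * (ι b₁ + ι b₂)) • f x + f x := by
      have h1 : (m * ι b₁ - 1) * (m * ι b₂ - 1) = m * m * (ι b₁ * ι b₂) - m * (ι b₁ + ι b₂) + 1 := by ring
      rw [h1, add_smul, sub_smul, one_smul]
    rw [this]; exact hrel
  rcases mul_eq_zero.mp ((smul_eq_zero.mp key).resolve_right hx) with h | h
  · exact Or.inl (eq_inv_of_mul_eq_one_left (sub_eq_zero.mp h))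
  · exact Or.inr (eq_inv_of_mul_eq_one_left (sub_eq_zero.mp h))

end Steps

section Derived

variable (C : Sec42Data P5 isotropicAt) (ℓ : ℕ) [Fact ℓ.Prime] (X : C.EtaleHeckeDatum ℓ)
  (ι : ℂ ≃+* AlgebraicClosure ℚ_[ℓ]) {W : Type} [AddCommGroup W] [Module ℂ W] (ρW : Representation ℂ C.G W)

/-- **How the FACT S1 delivers GS1.**  If the Hom-space `Hom(ι ∘ ω⋆, ℚ̄_ℓ ⊗ H¹_ét)` is spanned by ONE element `f₀`
(S1 clause (1): multiplicity at most one), then `Γ_E` acts on the block of values by scalars: `Φ_σ ∘ f₀` lies in the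
Hom-space (★ `towerRep_comp_mem_omegaHom`: the Hecke action commutes with `Γ_E`), hence is `m(σ) • f₀`.
[cite: Liu2021, App. D, proof of Thm. D.6 (1) (FJcycle.tex l. 5619–5632)] -/
theorem gs1_of_span_singleton
    {f₀ : W →ₛₗ[(ι : ℂ →+* AlgebraicClosure ℚ_[ℓ])] AlgebraicClosure ℚ_[ℓ] ⊗[ℚ_[ℓ]] C.etaleH1Tower ℓ}
    (hf₀ : f₀ ∈ X.omegaHom ι ρW)
    (hspan : ∀ f ∈ X.omegaHom ι ρW, ∃ a : AlgebraicClosure ℚ_[ℓ], f = a • f₀) :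
    (∃ m : Field.absoluteGaloisGroup E → AlgebraicClosure ℚ_[ℓ],
      ∀ σ : Field.absoluteGaloisGroup E, ∀ f ∈ X.omegaHom ι ρW, ∀ w : W,
        (C.towerRep ℓ σ).baseChange (AlgebraicClosure ℚ_[ℓ]) (f w) = m σ • f w) :=
  X.exists_towerRep_baseChange_apply_eq_smul_of_le_span_singleton ι ρW hf₀ hspan

/-- **S3, geometric form ⇒ arithmetic-inverse form.**  The card states the congruence relation for the GEOMETRIC Frobenius
`Φ_g = Φ_{σ⁻¹}`: `Φ_g(Φ_g y) − Φ_g y_T + q • y_S = 0`; applying `Φ_σ²` gives the form GS34 carries: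
`q • Φ_σ(Φ_σ y_S) − Φ_σ y_T + y = 0` (pure bookkeeping: `Φ_σ Φ_{σ⁻¹} = 1`).
[cite: Liu2021, App. D, proof of Thm. D.6 (1) (FJcycle.tex l. 5619–5632)] -/
theorem s3_arith_of_geom (σ : Field.absoluteGaloisGroup E) {y yT yS : AlgebraicClosure ℚ_[ℓ] ⊗[ℚ_[ℓ]] C.etaleH1Tower ℓ}
    {q : AlgebraicClosure ℚ_[ℓ]}
    (h : (C.towerRep ℓ σ⁻¹).baseChange (AlgebraicClosure ℚ_[ℓ])
        ((C.towerRep ℓ σ⁻¹).baseChange (AlgebraicClosure ℚ_[ℓ]) y) -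
      (C.towerRep ℓ σ⁻¹).baseChange (AlgebraicClosure ℚ_[ℓ]) yT + q • yS = 0) :
    q • (C.towerRep ℓ σ).baseChange (AlgebraicClosure ℚ_[ℓ])
        ((C.towerRep ℓ σ).baseChange (AlgebraicClosure ℚ_[ℓ]) yS) -
      (C.towerRep ℓ σ).baseChange (AlgebraicClosure ℚ_[ℓ]) yT + y = 0 := by
  have hinv : ∀ z : AlgebraicClosure ℚ_[ℓ] ⊗[ℚ_[ℓ]] C.etaleH1Tower ℓ,
      (C.towerRep ℓ σ).baseChange (AlgebraicClosure ℚ_[ℓ]) ((C.towerRep ℓ σ⁻¹).baseChange (AlgebraicClosure ℚ_[ℓ]) z) = z := by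
    intro z
    rw [← LinearMap.comp_apply, ← LinearMap.baseChange_comp, ← Module.End.mul_eq_comp, ← map_mul, mul_inv_cancel,
      map_one, Module.End.one_eq_id, LinearMap.baseChange_id, LinearMap.id_apply]
  have h2 := congrArg (fun z => (C.towerRep ℓ σ).baseChange (AlgebraicClosure ℚ_[ℓ])
    ((C.towerRep ℓ σ).baseChange (AlgebraicClosure ℚ_[ℓ]) z)) h
  simp only [map_add, map_sub, map_smul, map_zero, hinv] at h2
  rw [← h2]
  abel

/-- **S3, arithmetic-inverse form ⇒ geometric form** (the converse bookkeeping).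
[cite: Liu2021, App. D, proof of Thm. D.6 (1) (FJcycle.tex l. 5619–5632)] -/
theorem s3_geom_of_arith (σ : Field.absoluteGaloisGroup E) {y yT yS : AlgebraicClosure ℚ_[ℓ] ⊗[ℚ_[ℓ]] C.etaleH1Tower ℓ}
    {q : AlgebraicClosure ℚ_[ℓ]}
    (h : q • (C.towerRep ℓ σ).baseChange (AlgebraicClosure ℚ_[ℓ])
        ((C.towerRep ℓ σ).baseChange (AlgebraicClosure ℚ_[ℓ]) yS) -
      (C.towerRep ℓ σ).baseChange (AlgebraicClosure ℚ_[ℓ]) yT + y = 0) :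
    (C.towerRep ℓ σ⁻¹).baseChange (AlgebraicClosure ℚ_[ℓ])
        ((C.towerRep ℓ σ⁻¹).baseChange (AlgebraicClosure ℚ_[ℓ]) y) -
      (C.towerRep ℓ σ⁻¹).baseChange (AlgebraicClosure ℚ_[ℓ]) yT + q • yS = 0 := by
  have hinv : ∀ z : AlgebraicClosure ℚ_[ℓ] ⊗[ℚ_[ℓ]] C.etaleH1Tower ℓ,
      (C.towerRep ℓ σ⁻¹).baseChange (AlgebraicClosure ℚ_[ℓ]) ((C.towerRep ℓ σ).baseChange (AlgebraicClosure ℚ_[ℓ]) z) = z := by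
    intro z
    rw [← LinearMap.comp_apply, ← LinearMap.baseChange_comp, ← Module.End.mul_eq_comp, ← map_mul, inv_mul_cancel,
      map_one, Module.End.one_eq_id, LinearMap.baseChange_id, LinearMap.id_apply]
  have h2 := congrArg (fun z => (C.towerRep ℓ σ⁻¹).baseChange (AlgebraicClosure ℚ_[ℓ])
    ((C.towerRep ℓ σ⁻¹).baseChange (AlgebraicClosure ℚ_[ℓ]) z)) h
  simp only [map_add, map_sub, map_smul, map_zero, hinv] at h2
  rw [← h2]
  abel

/-- **How the FACT S1 (multiplicity ≤ 1, «pairwise proportional» form of card §1) delivers GS1**: if any two elements of the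
Hom-space are proportional, the Hom-space is spanned by one element (any non-zero one, or `0`), so `gs1_of_span_singleton`
applies. [cite: Liu2021, Prop. D.4 (1) p. 130] -/
theorem gs1_of_pairwise_proportional
    (hprop : ∀ f ∈ X.omegaHom ι ρW, ∀ g ∈ X.omegaHom ι ρW, ∃ a : AlgebraicClosure ℚ_[ℓ], g = a • f ∨ f = a • g) :
    (∃ m : Field.absoluteGaloisGroup E → AlgebraicClosure ℚ_[ℓ],
      ∀ σ : Field.absoluteGaloisGroup E, ∀ f ∈ X.omegaHom ι ρW, ∀ w : W,
        (C.towerRep ℓ σ).baseChange (AlgebraicClosure ℚ_[ℓ]) (f w) = m σ • f w) :=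
  X.exists_towerRep_baseChange_apply_eq_smul_of_pairwise ι ρW hprop

end Derived

section Main

variable [IsCMField E]
variable (C : Sec42Data P5 isotropicAt) (ℓ : ℕ) [Fact ℓ.Prime] (X : C.EtaleHeckeDatum ℓ)
  (ι : ℂ ≃+* AlgebraicClosure ℚ_[ℓ]) {W : Type} [AddCommGroup W] [Module ℂ W] (ρW : Representation ℂ C.G W)

/-- **STEPS 2–5 OF THE d6 COMPOSITION, GENERIC.**  For `μ` conjugate-symplectic, `μ₁ := μ^{alg}`,
`μ₂ := (μ^{alg})^c · η` (`η` of infinity type `(0,0)`, e.g. `χ̌`), a non-trivial `c ∈ Aut(E/F)` (the split predicate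
`c • v ≠ v`), and the three sockets GS1 (scalar action), GS2 (one CM eigen-class with first exponent `(1 − e(w₁))/2` at
`w₁`), GS34 (SM ⊕ S3 ⊕ S4): at EVERY place `v ∤ ℓ` where `μ^{alg}` is unramified, every arithmetic Frobenius acts on every
value `f w` of the block by `(ι (μ^{alg}(ϖ_v)))⁻¹`.  Step 2 = `scalar_eq_inv_or_eq_inv` at one spherical vector with
non-zero value (SM); step 3 = ★ `HeckeCharacter.IsAlgebraic.eq_or_eq_of_valueAtUniformizer_of_dense` on the `c`-split
places off a finite set, dense by ★ `absoluteGaloisGroup.frobenius_dense_smul_ne`; step 4 = infinity types at the complex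
place `w₁` (★ `HasInfinityType.eq_of_isComplex`, `e(w₁)` odd); step 5 = ★ `towerRep_baseChange_eq_inv_smul_of_eventually`.
[cite: Liu2021, App. D, proof of Thm. D.6 (1) (FJcycle.tex l. 5619–5632)] -/
theorem towerRep_eq_inv_smul_muAlg_of_sockets
    {μ : Literature.NumberTheory.Automorphic.IdeleClassGroup E →ₜ* Circle}
    (hμ : IdeleClassGroup.IsConjugateSymplectic E μ) (w₁ : InfinitePlace E)
    (c : E ≃ₐ[F] E) (hc : c ≠ 1) {η : HeckeCharacter E} (hη : η.HasInfinityType (fun _ => 0) (fun _ => 0))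
    (h1 : ∃ m : Field.absoluteGaloisGroup E → AlgebraicClosure ℚ_[ℓ],
      ∀ σ : Field.absoluteGaloisGroup E, ∀ f ∈ X.omegaHom ι ρW, ∀ w : W,
        (C.towerRep ℓ σ).baseChange (AlgebraicClosure ℚ_[ℓ]) (f w) = m σ • f w)
    (h2 : (∃ f ∈ X.omegaHom ι ρW, ∃ w : W, f w ≠ 0) →
      ∃ ψ : HeckeCharacter E, (∃ p q : InfinitePlace E → ℤ, ψ.HasInfinityType p q ∧ p w₁ = (1 - hμ.infinityType w₁) / 2) ∧
        ∃ y ∈ Submodule.span (AlgebraicClosure ℚ_[ℓ]) {y | ∃ f ∈ X.omegaHom ι ρW, ∃ w : W, f w = y}, y ≠ 0 ∧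
          ∀ᶠ v : HeightOneSpectrum (𝓞 E) in cofinite, (ℓ : 𝓞 E) ∉ v.asIdeal →
            ∀ 𝔓 ∈ v.primesAbove, ∀ σ : Field.absoluteGaloisGroup E, IsArithFrobAt (𝓞 E) σ 𝔓 →
              (C.towerRep ℓ σ).baseChange (AlgebraicClosure ℚ_[ℓ]) y = (ι (ψ.valueAtUniformizer v))⁻¹ • y)
    (h34 : ∃ (Sph : HeightOneSpectrum (𝓞 E) → Set W) (T S : HeightOneSpectrum (𝓞 E) → (W →ₗ[ℂ] W))
      (S₀ : Set (HeightOneSpectrum (𝓞 E))), S₀.Finite ∧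
      (∀ x : W, ∀ᶠ v : HeightOneSpectrum (𝓞 E) in cofinite, x ∈ Sph v) ∧
      (∀ v ∉ S₀, c • v ≠ v → ∀ 𝔓 ∈ v.primesAbove, ∀ σ : Field.absoluteGaloisGroup E, IsArithFrobAt (𝓞 E) σ 𝔓 →
        ∀ f ∈ X.omegaHom ι ρW, ∀ x ∈ Sph v,
          (Ideal.absNorm v.asIdeal : AlgebraicClosure ℚ_[ℓ]) •
              (C.towerRep ℓ σ).baseChange (AlgebraicClosure ℚ_[ℓ])
                ((C.towerRep ℓ σ).baseChange (AlgebraicClosure ℚ_[ℓ]) (f (S v x))) -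
            (C.towerRep ℓ σ).baseChange (AlgebraicClosure ℚ_[ℓ]) (f (T v x)) + f x = 0) ∧
      (∀ v ∉ S₀, c • v ≠ v → ∀ x ∈ Sph v,
        T v x = ((IdeleClassGroup.muAlg E μ).valueAtUniformizer v + (HeckeCharacter.galConj (IsCMField.complexConj E) (IdeleClassGroup.muAlg E μ) * η).valueAtUniformizer v) • x ∧
        (Ideal.absNorm v.asIdeal : ℂ) • S v x = ((IdeleClassGroup.muAlg E μ).valueAtUniformizer v * (HeckeCharacter.galConj (IsCMField.complexConj E) (IdeleClassGroup.muAlg E μ) * η).valueAtUniformizer v) • x))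
    {v : HeightOneSpectrum (𝓞 E)} (hvℓ : (ℓ : 𝓞 E) ∉ v.asIdeal) (hv : (IdeleClassGroup.muAlg E μ).IsUnramifiedAt v)
    {𝔓 : Ideal (absIntegers (𝓞 E) E)} (h𝔓 : 𝔓 ∈ v.primesAbove)
    {σ : Field.absoluteGaloisGroup E} (hσ : IsArithFrobAt (𝓞 E) σ 𝔓)
    {f : W →ₛₗ[(ι : ℂ →+* AlgebraicClosure ℚ_[ℓ])] AlgebraicClosure ℚ_[ℓ] ⊗[ℚ_[ℓ]] C.etaleH1Tower ℓ}
    (hf : f ∈ X.omegaHom ι ρW) (w : W) :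
    (C.towerRep ℓ σ).baseChange (AlgebraicClosure ℚ_[ℓ]) (f w) =
      (ι ((IdeleClassGroup.muAlg E μ).valueAtUniformizer v))⁻¹ • f w := by
  classical
  -- the zero block: nothing to prove
  by_cases h0 : ∃ f ∈ X.omegaHom ι ρW, ∃ w : W, f w ≠ 0
  swap
  · push Not at h0
    rw [h0 f hf w, map_zero, smul_zero]
  obtain ⟨m, hm⟩ := h1
  obtain ⟨ψ, ⟨p, q, hpq, hp1⟩, y, hyspan, hy0, hcof⟩ := h2 h0
  obtain ⟨Sph, T, S, S₀, hS₀, hSM, hS3, hS4⟩ := h34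
  obtain ⟨f₀, hf₀, x₀, hx₀⟩ := h0
  -- (1) the scalar `m σ'` is read off the ONE eigen-class `y ≠ 0` in the span of the block
  have hread : ∀ {v' : HeightOneSpectrum (𝓞 E)} {σ' : Field.absoluteGaloisGroup E},
      (C.towerRep ℓ σ').baseChange (AlgebraicClosure ℚ_[ℓ]) y = (ι (ψ.valueAtUniformizer v'))⁻¹ • y →
        m σ' = (ι (ψ.valueAtUniformizer v'))⁻¹ := by
    intro v' σ' hy
    rw [towerRep_eq_smul_of_mem_span C ℓ X ι ρW hm σ' hyspan] at hy
    exact smul_left_injective _ hy0 hy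
  -- (2) the label-dependent finite exceptional sets
  have hTψ : {v' : HeightOneSpectrum (𝓞 E) | ¬ ((ℓ : 𝓞 E) ∉ v'.asIdeal →
      ∀ 𝔓' ∈ v'.primesAbove, ∀ σ' : Field.absoluteGaloisGroup E, IsArithFrobAt (𝓞 E) σ' 𝔓' →
        (C.towerRep ℓ σ').baseChange (AlgebraicClosure ℚ_[ℓ]) y = (ι (ψ.valueAtUniformizer v'))⁻¹ • y)}.Finite :=
    Filter.eventually_cofinite.mp hcof
  have hEx : {v' : HeightOneSpectrum (𝓞 E) | ¬ (x₀ ∈ Sph v')}.Finite := Filter.eventually_cofinite.mp (hSM x₀)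
  set Bad : Set (HeightOneSpectrum (𝓞 E)) := ((S₀ ∪ {v' : HeightOneSpectrum (𝓞 E) | ¬ ((ℓ : 𝓞 E) ∉ v'.asIdeal →
      ∀ 𝔓' ∈ v'.primesAbove, ∀ σ' : Field.absoluteGaloisGroup E, IsArithFrobAt (𝓞 E) σ' 𝔓' →
        (C.towerRep ℓ σ').baseChange (AlgebraicClosure ℚ_[ℓ]) y = (ι (ψ.valueAtUniformizer v'))⁻¹ • y)}) ∪
      {v' : HeightOneSpectrum (𝓞 E) | ¬ (x₀ ∈ Sph v')}) ∪ {v' : HeightOneSpectrum (𝓞 E) | (ℓ : 𝓞 E) ∈ v'.asIdeal}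
    with hBad_def
  have hBad : Bad.Finite := ((hS₀.union hTψ).union hEx).union (finite_setOf_natCast_mem_asIdeal ℓ)
  -- (3) STEP 2 at every `c`-split place off `Bad`: `ψ(ϖ) ∈ {μ₁(ϖ), μ₂(ϖ)}`
  have hdich : ∀ v' ∈ {v' : HeightOneSpectrum (𝓞 E) | c • v' ≠ v'} \ Bad,
      ψ.valueAtUniformizer v' = (IdeleClassGroup.muAlg E μ).valueAtUniformizer v' ∨
        ψ.valueAtUniformizer v' =
          (HeckeCharacter.galConj (IsCMField.complexConj E) (IdeleClassGroup.muAlg E μ) * η).valueAtUniformizer v' := by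
    rintro v' ⟨hsplit, hnot⟩
    simp only [hBad_def, Set.mem_union, Set.mem_setOf_eq, not_or, not_not] at hnot
    obtain ⟨⟨⟨hS₀', hgood⟩, hx₀'⟩, hℓ'⟩ := hnot
    obtain ⟨𝔓', h𝔓'⟩ := HeightOneSpectrum.primesAbove_nonempty v'
    obtain ⟨σ', hσ'⟩ := HeightOneSpectrum.exists_isArithFrobAt_of_mem_primesAbove_holds h𝔓'
    have e1 : m σ' = (ι (ψ.valueAtUniformizer v'))⁻¹ := hread (hgood hℓ' 𝔓' h𝔓' σ' hσ')
    obtain ⟨hT', hS'⟩ := hS4 v' hS₀' hsplit x₀ hx₀'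
    have e2 := scalar_eq_inv_or_eq_inv C ℓ ι (hm σ' f₀ hf₀) hT' hS'
      (hS3 v' hS₀' hsplit 𝔓' h𝔓' σ' hσ' f₀ hf₀ x₀ hx₀') hx₀
    rw [e1] at e2
    simpa only [inv_inj, EmbeddingLike.apply_eq_iff_eq] using e2
  -- (4) STEP 3: `ψ = μ₁ ∨ ψ = μ₂` (algebraic characters agreeing with one of two at a Frobenius-dense set of places)
  have hψalg : ψ.IsAlgebraic := (HeckeCharacter.isAlgebraic_iff_exists_hasInfinityType ψ).mpr ⟨p, q, hpq⟩
  have hμ₁alg : (IdeleClassGroup.muAlg E μ).IsAlgebraic := hμ.isAlgebraic_muAlg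
  have hμ₂inf := hμ.hasInfinityType_galConj_muAlg.mul' hη
  have hμ₂alg : (HeckeCharacter.galConj (IsCMField.complexConj E) (IdeleClassGroup.muAlg E μ) * η).IsAlgebraic :=
    (HeckeCharacter.isAlgebraic_iff_exists_hasInfinityType _).mpr ⟨_, _, hμ₂inf⟩
  have hP : ∀ T : Set (HeightOneSpectrum (𝓞 E)), T.Finite →
      Dense {τ : Field.absoluteGaloisGroup E | ∃ v' ∈ {v' : HeightOneSpectrum (𝓞 E) | c • v' ≠ v'} \ Bad, v' ∉ T ∧
        ∃ 𝔓' ∈ v'.primesAbove, IsArithFrobAt (𝓞 E) τ 𝔓'} := by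
    intro T hT
    refine (absoluteGaloisGroup.frobenius_dense_smul_ne F E hc (T ∪ Bad) (hT.union hBad)).mono ?_
    rintro τ ⟨v', hv', hvT, 𝔓', h𝔓', hτ⟩
    rw [Set.mem_union, not_or] at hvT
    exact ⟨v', ⟨hv', hvT.2⟩, hvT.1, 𝔓', h𝔓', hτ⟩
  have h3 := hψalg.eq_or_eq_of_valueAtUniformizer_of_dense hμ₁alg hμ₂alg _ hP hdich
  -- (5) STEP 4: `ψ ≠ μ₂` — first exponents `(1 − e)/2 ≠ (1 + e)/2` at the complex place `w₁` (`e` odd)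
  have h4 : ψ ≠ HeckeCharacter.galConj (IsCMField.complexConj E) (IdeleClassGroup.muAlg E μ) * η := by
    intro heq
    rw [heq] at hpq
    obtain ⟨hp, -⟩ := hpq.eq_of_isComplex hμ₂inf (IsTotallyComplex.isComplex w₁)
    obtain ⟨k, hk⟩ := hμ.odd_infinityType w₁
    simp only [Pi.add_apply] at hp
    rw [hp1, hk] at hp
    omega
  have hψμ : ψ = IdeleClassGroup.muAlg E μ := h3.resolve_right h4
  -- (6) STEP 5: the label-free exceptional set `{v ∣ ℓ} ∪ ram(μ^{alg})`
  refine C.towerRep_baseChange_eq_inv_smul_of_eventually ℓ ι hμ₁alg (f w) ?_ hvℓ hv h𝔓 hσ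
  filter_upwards [hcof] with v' hv' hℓ' 𝔓' h𝔓' σ' hσ'
  rw [hm σ' f hf w, hread (hv' hℓ' 𝔓' h𝔓' σ' hσ'), hψμ]

end Main

end Literature.NumberTheory.Automorphic.Liu2021.AppendixC.ThmD6Glue

end
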